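import Literature.NumberTheory.Automorphic.UnitaryGroupArthurTraceTwoSockets
import Literature.NumberTheory.Automorphic.UnitaryGroupTruncatedTraceClassEllipticKitTwo
import HarnessLib

/-!
# LAW 5's two sockets of `U(J₂)` IN KIT CURRENCY: `J(f)` on the quasi-split `U(J₂)` of a CM field with the ELLIPTIC orbital sums over the
# RATIONAL conjugacy classes along `toAdelic` and class-indexed orbital integrals `classOrbitalIntegralAlong toAdelic m f c`
(Rogawski (1990), §2.2–§2.3 pp. 13–14, §5.4 p. 71, §7.3 p. 98 «Let `G = U(3)`, `U(2)`, or `U(2) × U(1)`»; Arthur (1978), §8.)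

Topic `NumberTheory/Automorphic`; namespace `Literature.NumberTheory.Automorphic.UnitaryGroup`. THEOREMS ONLY (no definition, no instance, no
named fact, no notation, no `sorry`). H-SIDE copy (endoscopic group `H = U(Φ₂) × U(Φ₁)`, rank-one factor `U(J₂)`) of row (L5-KIT) «THE SOCKETS IN
KIT CURRENCY» of the T1-qs road of `Cruxes/H413/Lines/F0_T1InnerFormTraceIdentity.lean` (cell `pub/hodgecm-mathlib`, crux H413 =
`stmt-HodgeConjecture-24833`; LEAD WORD H-2 item 3; acting H-desk F0P3a-p06 (g6); pen A-p18 (g21)); the `N = 2` twin of ★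
`UnitaryGroupArthurTraceThreeSocketsKit` (F0P3a-p01), proofs verbatim.

WHY. The `N = 2` socket of record ★ `arthurTrace_eq_sum_orbital_add_sum_central_add_sum_hyperbolic_cm_two` (`UnitaryGroupArthurTraceTwoSockets`)
indexes the ELLIPTIC term of Arthur's `J(f)` by the conjugacy classes of the ARITHMETIC subgroup `G(L⁺)·1 ⊂ G(𝔸)` at an arbitrary section `rep` with
centraliser measures `νC`; the stabilisation kit (★ `UnitaryGroupStableOrbitalIntegral` §1, every `N`) indexes orbital integrals by `ConjClasses G(L⁺)`
along `toAdelic`. This file is the one-step translation at the `J(f)` level, summand by summand the move of the `N = 2` LAW 4 kit corollary ★ (L4-g)₂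
`truncatedTraceClass_eq_mul_tsum_covol_mul_classOrbitalIntegralAlong_cm_two` (`UnitaryGroupTruncatedTraceClassEllipticKitTwo`, F0P3a-p06):
`G(L⁺) ≃* G(L⁺)·1` (★ `cmDatum_toAdelic_injective`), the induced bijection of classes (★ `Rogawski1990.bijective_conjClassesMap_of_mulEquiv`), the section
`rep s := (out (e⁻¹ s))·1`, `νC s := νR (e⁻¹ s)`, and `Equiv.tsum_eq` inside each elliptic summand — no dependent rewriting, no new mathematics.

* **`arthurTrace_eq_sum_classOrbitalIntegralAlong_add_sum_central_add_sum_hyperbolic_cm_two`** — for the CM pair, EVERY `T`, any total family `m` on the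
  rational classes which IS the Weil quotient `ν ∕ νR c` on the elliptic classes:
  `J(f) = Σ_{i ∈ S♭_f elliptic} c_μ · Σ'_{c : cl♭(γ_c·1) = i} covol(G_{γ_c}(L⁺)·1 ∖ G_{γ_c}(𝔸); νR c) · classOrbitalIntegralAlong toAdelic m f c
        + (Σ_{central} p_i(0) + Σ_{regular hyperbolic} p_i(0))`.
* **`…_add_two_sockets_of_eq_quotientMeasure_cm_two`** — the same AT THE WEIL MEASURE `μ = ν ∕ count`: NO constant, weights = covolumes (★ (L4-g)₂ §2 pattern).

HC_CM is proved only modulo the 7 printed citations until rung 0 closes — nothing here bears on a summit statement.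

## References
* [Rogawski1990] J. D. Rogawski, *Automorphic Representations of Unitary Groups in Three Variables*, Ann. of Math. Stud. 123 (1990), §2.2–§2.3
  (pp. 13–14), §5.4 p. 71, §7.3 p. 98, §14.5 pp. 237–238.
* [Arthur1978TraceFormulaI] J. Arthur, *A trace formula for reductive groups I*, Duke Math. J. 45 (1978), §8.
* [Gelbart1975] S. Gelbart, *Automorphic forms on adele groups*, Ann. of Math. Stud. 83 (1975), (9.13), Thm. 9.22 (ii).
-/

set_option autoImplicit false

noncomputable section

open MeasureTheory Measure NumberField NumberField.mixedEmbedding IsDedekindDomain Set Polynomial Topology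
open Literature.MeasureTheory.Group
open scoped NNReal ENNReal Pointwise MatrixGroups Classical

namespace Literature.NumberTheory.Automorphic

namespace UnitaryGroup

/-! ## §1 Bookkeeping (private) -/

/-- `[out c] = c` for conjugacy classes. [folklore] -/
private theorem conjClasses_mk_out₆ {A : Type*} [Monoid A] (c : ConjClasses A) : ConjClasses.mk (Quotient.out c) = c := by
  rw [← ConjClasses.quotient_mk_eq_mk, Quotient.out_eq]

/-- Re-indexing a `tsum` over a subtype along an equivalence of the ambient index types, summand by summand. [folklore] -/
private theorem tsum_subtype_reindex₆ {α β : Type*} (e : α ≃ β) (P : β → Prop) (G : {a // P (e a)} → ℂ)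
    (F : {b // P b} → ℂ) (h : ∀ a, G a = F ⟨e a.1, a.2⟩) : ∑' a, G a = ∑' b, F b := by
  rw [← (Equiv.subtypeEquiv e fun _ => Iff.rfl).tsum_eq F]
  exact tsum_congr fun a => h a

/-- `classOrbitalIntegralAlong ι m f c` read at a propositionally equal orbit measure `m c = μ'`. [cite: Rogawski1990, §5.4 p. 71] -/
private theorem classOrbitalIntegralAlong_eq_of_eq₆ {Γ G : Type*} [Group Γ] [Group G] (ι : Γ →* G)
    [∀ g : G, MeasurableSpace (G ⧸ Subgroup.centralizer ({g} : Set G))]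
    (m : OrbitalMeasureFamilyAlong ι) (f : G → ℂ) (c : ConjClasses Γ)
    {μ' : Measure (G ⧸ Subgroup.centralizer ({ι (Quotient.out c)} : Set G))} (h : m c = μ') :
    classOrbitalIntegralAlong ι m f c = orbitalIntegral (ι (Quotient.out c)) f μ' := by
  subst h
  exact classOrbitalIntegralAlong_eq ι m f c

/-! ## §2 The two sockets with the elliptic term over the rational classes -/
/-- **LAW 5's TWO SOCKETS OF `U(J₂)` IN KIT CURRENCY — `J(f) = Σ_{elliptic i} c_μ Σ'_{[γ] ↦ i} covol[γ] · Φ_𝔸([γ]; m; f) + Σ_{central} p_i(0) +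
Σ_{regular hyperbolic} p_i(0)` with the ELLIPTIC orbital sums over the RATIONAL conjugacy classes of `G(L⁺) = (quasiSplit L⁺ L c 2).Rational`.**
★ `arthurTrace_eq_sum_orbital_add_sum_central_add_sum_hyperbolic_cm_two` (`UnitaryGroupArthurTraceTwoSockets`, the `N = 2` socket of record) with
its first sum — the Borel-refined classes MISSING `B(L⁺)` — RE-INDEXED exactly as the `N = 2` LAW 4 kit corollary ★ (L4-g)₂
`truncatedTraceClass_eq_mul_tsum_covol_mul_classOrbitalIntegralAlong_cm_two` (`UnitaryGroupTruncatedTraceClassEllipticKitTwo`) does class by class: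
along the diagonal `toAdelic : G(L⁺) ≃* G(L⁺)·1` (★ `cmDatum_toAdelic_injective`, classes through ★ `Rogawski1990.bijective_conjClassesMap_of_mulEquiv`),
at the section `rep s := (out (e⁻¹ s))·1`, with the centraliser Haar measures `νR c` and the kit's class-indexed orbital integrals ★
`classOrbitalIntegralAlong toAdelic m f c` (`UnitaryGroupStableOrbitalIntegral` §1, every `N`) for ANY total family `m` on `ConjClasses G(L⁺)` agreeing
with the Weil quotients `ν ∕ νR c` on the ELLIPTIC classes (hypothesis after the preamble; right∕inversion invariance of `νR c` there by ★
`isMulRightInvariant_centralizer_of_forall_cl_ne_two` ∕ ★ `isInvInvariant_centralizer_of_forall_cl_ne_two`). The two socket sums (central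
`((X − z)²).map`, `z ∈ L¹`; regular hyperbolic `((X − a)(X − (c a)⁻¹)).map`, `c a · a ≠ 1`) and the four bookkeeping conjuncts (`P`, its degree, the
live set `S♭_f`, the constant classes) are the socket's VERBATIM; NO hypothesis beyond the letters. The `N = 2` twin of ★
`arthurTrace_eq_sum_classOrbitalIntegralAlong_add_sum_central_add_sum_singular_add_sum_hyperbolic_cm` (`UnitaryGroupArthurTraceThreeSocketsKit`), proof verbatim.
[cite: Rogawski1990, §2.2–2.3 (pp. 13–14); §5.4 p. 71; §7.3 (p. 98)] [cite: Arthur1978TraceFormulaI, §8] -/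
theorem arthurTrace_eq_sum_classOrbitalIntegralAlong_add_sum_central_add_sum_hyperbolic_cm_two (L : Type) [Field L] [NumberField L] [IsCMField L]
    [instMA : MeasurableSpace (quasiSplit (↥(maximalRealSubfield L)) L (IsCMField.complexConj L) 2).Adelic] [instBA : BorelSpace (quasiSplit (↥(maximalRealSubfield L)) L (IsCMField.complexConj L) 2).Adelic]
    (ν : Measure (quasiSplit (↥(maximalRealSubfield L)) L (IsCMField.complexConj L) 2).Adelic) [instν : IsHaarMeasure ν]
    (μ : Measure (quasiSplit (↥(maximalRealSubfield L)) L (IsCMField.complexConj L) 2).automorphicQuotient)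
    [instμ : (quasiSplit (↥(maximalRealSubfield L)) L (IsCMField.complexConj L) 2).IsAutomorphicMeasure μ]
    [instMU : MeasurableSpace (adelicUnipotent (↥(maximalRealSubfield L)) L (IsCMField.complexConj L) 2)]
    [instBU : BorelSpace (adelicUnipotent (↥(maximalRealSubfield L)) L (IsCMField.complexConj L) 2)]
    [instMQ : ∀ γ : (quasiSplit (↥(maximalRealSubfield L)) L (IsCMField.complexConj L) 2).Adelic,
      MeasurableSpace ((quasiSplit (↥(maximalRealSubfield L)) L (IsCMField.complexConj L) 2).Adelic ⧸
        Subgroup.centralizer ({γ} : Set (quasiSplit (↥(maximalRealSubfield L)) L (IsCMField.complexConj L) 2).Adelic))]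
    [instBQ : ∀ γ : (quasiSplit (↥(maximalRealSubfield L)) L (IsCMField.complexConj L) 2).Adelic,
      BorelSpace ((quasiSplit (↥(maximalRealSubfield L)) L (IsCMField.complexConj L) 2).Adelic ⧸
        Subgroup.centralizer ({γ} : Set (quasiSplit (↥(maximalRealSubfield L)) L (IsCMField.complexConj L) 2).Adelic))]
    [instMS : ∀ γ : (quasiSplit (↥(maximalRealSubfield L)) L (IsCMField.complexConj L) 2).Adelic,
      MeasurableSpace (↥(Subgroup.centralizer ({γ} : Set (quasiSplit (↥(maximalRealSubfield L)) L (IsCMField.complexConj L) 2).Adelic)) ⧸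
        ((quasiSplit (↥(maximalRealSubfield L)) L (IsCMField.complexConj L) 2).quotientSubgroup ⊓
          Subgroup.centralizer ({γ} : Set (quasiSplit (↥(maximalRealSubfield L)) L (IsCMField.complexConj L) 2).Adelic)).subgroupOf
          (Subgroup.centralizer ({γ} : Set (quasiSplit (↥(maximalRealSubfield L)) L (IsCMField.complexConj L) 2).Adelic)))]
    [instBS : ∀ γ : (quasiSplit (↥(maximalRealSubfield L)) L (IsCMField.complexConj L) 2).Adelic,
      BorelSpace (↥(Subgroup.centralizer ({γ} : Set (quasiSplit (↥(maximalRealSubfield L)) L (IsCMField.complexConj L) 2).Adelic)) ⧸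
        ((quasiSplit (↥(maximalRealSubfield L)) L (IsCMField.complexConj L) 2).quotientSubgroup ⊓
          Subgroup.centralizer ({γ} : Set (quasiSplit (↥(maximalRealSubfield L)) L (IsCMField.complexConj L) 2).Adelic)).subgroupOf
          (Subgroup.centralizer ({γ} : Set (quasiSplit (↥(maximalRealSubfield L)) L (IsCMField.complexConj L) 2).Adelic)))]
    (ν₀ : Measure (adelicUnipotent (↥(maximalRealSubfield L)) L (IsCMField.complexConj L) 2)) [instν₀ : ν₀.IsHaarMeasure]
    (𝓕 : Set (adelicUnipotent (↥(maximalRealSubfield L)) L (IsCMField.complexConj L) 2))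
    (h𝓕 : IsFundamentalDomain (rationalUnipotent (↥(maximalRealSubfield L)) L (IsCMField.complexConj L) 2) 𝓕 ν₀)
    (νR : ∀ c : ConjClasses (quasiSplit (↥(maximalRealSubfield L)) L (IsCMField.complexConj L) 2).Rational,
      Measure ↥(Subgroup.centralizer ({(quasiSplit (↥(maximalRealSubfield L)) L (IsCMField.complexConj L) 2).toAdelic (Quotient.out c)} : Set (quasiSplit (↥(maximalRealSubfield L)) L (IsCMField.complexConj L) 2).Adelic)))
    [instνR : ∀ c, IsHaarMeasure (νR c)]
    (m : ∀ c : ConjClasses (quasiSplit (↥(maximalRealSubfield L)) L (IsCMField.complexConj L) 2).Rational,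
      Measure ((quasiSplit (↥(maximalRealSubfield L)) L (IsCMField.complexConj L) 2).Adelic ⧸ Subgroup.centralizer ({(quasiSplit (↥(maximalRealSubfield L)) L (IsCMField.complexConj L) 2).toAdelic (Quotient.out c)} : Set (quasiSplit (↥(maximalRealSubfield L)) L (IsCMField.complexConj L) 2).Adelic)))
    (f : (quasiSplit (↥(maximalRealSubfield L)) L (IsCMField.complexConj L) 2).Adelic → ℂ)
    (hf : IsQuasiSplitTest (↥(maximalRealSubfield L)) L (IsCMField.complexConj L) 2 f) :
    haveI := t2Space_quasiSplitAdelic (F := ↥(maximalRealSubfield L)) (E := L) (c := IsCMField.complexConj L) (N := 2)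
    haveI := locallyCompactSpace_quasiSplitAdelic (F := ↥(maximalRealSubfield L)) (E := L) (c := IsCMField.complexConj L) (N := 2)
    haveI := secondCountableTopology_quasiSplitAdelic (F := ↥(maximalRealSubfield L)) (E := L) (c := IsCMField.complexConj L) (N := 2)
    haveI : IsClosed (((quasiSplit (↥(maximalRealSubfield L)) L (IsCMField.complexConj L) 2).quotientSubgroup : Set (quasiSplit (↥(maximalRealSubfield L)) L (IsCMField.complexConj L) 2).Adelic)) :=
      isClosed_quotientSubgroup_quasiSplit
    haveI : ∀ γ : (quasiSplit (↥(maximalRealSubfield L)) L (IsCMField.complexConj L) 2).Adelic, IsClosed ((Subgroup.centralizer ({γ} : Set (quasiSplit (↥(maximalRealSubfield L)) L (IsCMField.complexConj L) 2).Adelic) :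
        Subgroup (quasiSplit (↥(maximalRealSubfield L)) L (IsCMField.complexConj L) 2).Adelic) : Set (quasiSplit (↥(maximalRealSubfield L)) L (IsCMField.complexConj L) 2).Adelic) := isClosed_centralizer_quasiSplit
    haveI : ∀ γ : (quasiSplit (↥(maximalRealSubfield L)) L (IsCMField.complexConj L) 2).Adelic, (count : Measure ↥(((quasiSplit (↥(maximalRealSubfield L)) L (IsCMField.complexConj L) 2).quotientSubgroup ⊓
        Subgroup.centralizer ({γ} : Set (quasiSplit (↥(maximalRealSubfield L)) L (IsCMField.complexConj L) 2).Adelic)).subgroupOf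
          (Subgroup.centralizer ({γ} : Set (quasiSplit (↥(maximalRealSubfield L)) L (IsCMField.complexConj L) 2).Adelic)))).IsHaarMeasure :=
      isHaarMeasure_count_inf_centralizer_subgroupOf_quasiSplit
    haveI : (count : Measure (quasiSplit (↥(maximalRealSubfield L)) L (IsCMField.complexConj L) 2).quotientSubgroup).IsHaarMeasure :=
      isHaarMeasure_count_quotientSubgroup_quasiSplit
    haveI : ν.IsMulRightInvariant := isMulRightInvariant_quasiSplit_cm_two L ν
    letI := AdelicGroupData.measurableSpaceQuotientForm (quasiSplit (↥(maximalRealSubfield L)) L (IsCMField.complexConj L) 2)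
    haveI := AdelicGroupData.borelSpaceQuotientForm (quasiSplit (↥(maximalRealSubfield L)) L (IsCMField.complexConj L) 2)
    haveI := AdelicGroupData.smulInvariantMeasureQuotientForm (quasiSplit (↥(maximalRealSubfield L)) L (IsCMField.complexConj L) 2) μ
    haveI := AdelicGroupData.isFiniteMeasureOnCompactsQuotientForm (quasiSplit (↥(maximalRealSubfield L)) L (IsCMField.complexConj L) 2) μ
    (∀ (c : ConjClasses (quasiSplit (↥(maximalRealSubfield L)) L (IsCMField.complexConj L) 2).Rational)
        (hc : ∀ β : ↥(arithmeticBorel (↥(maximalRealSubfield L)) L (IsCMField.complexConj L) 2),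
          (((adelicVal (↥(maximalRealSubfield L)) L (IsCMField.complexConj L) 2 _ ((β : ↥(quasiSplit (↥(maximalRealSubfield L)) L (IsCMField.complexConj L) 2).arithmeticSubgroup) : (quasiSplit (↥(maximalRealSubfield L)) L (IsCMField.complexConj L) 2).Adelic) :
                GL (Fin 2) (AdeleRing (𝓞 L) L)) : Matrix (Fin 2) (Fin 2) (AdeleRing (𝓞 L) L)).charpoly,
              decide (∃ δ : ↥(quasiSplit (↥(maximalRealSubfield L)) L (IsCMField.complexConj L) 2).arithmeticSubgroup, δ * (β : ↥(quasiSplit (↥(maximalRealSubfield L)) L (IsCMField.complexConj L) 2).arithmeticSubgroup) * δ⁻¹ ∈ arithmeticBorel (↥(maximalRealSubfield L)) L (IsCMField.complexConj L) 2)) ≠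
          (((adelicVal (↥(maximalRealSubfield L)) L (IsCMField.complexConj L) 2 _ ((⟨(quasiSplit (↥(maximalRealSubfield L)) L (IsCMField.complexConj L) 2).toAdelic (Quotient.out c), Quotient.out c, rfl⟩ : ↥(quasiSplit (↥(maximalRealSubfield L)) L (IsCMField.complexConj L) 2).arithmeticSubgroup) : (quasiSplit (↥(maximalRealSubfield L)) L (IsCMField.complexConj L) 2).Adelic) :
                GL (Fin 2) (AdeleRing (𝓞 L) L)) : Matrix (Fin 2) (Fin 2) (AdeleRing (𝓞 L) L)).charpoly,
              decide (∃ δ : ↥(quasiSplit (↥(maximalRealSubfield L)) L (IsCMField.complexConj L) 2).arithmeticSubgroup, δ * ((⟨(quasiSplit (↥(maximalRealSubfield L)) L (IsCMField.complexConj L) 2).toAdelic (Quotient.out c), Quotient.out c, rfl⟩ : ↥(quasiSplit (↥(maximalRealSubfield L)) L (IsCMField.complexConj L) 2).arithmeticSubgroup)) * δ⁻¹ ∈ arithmeticBorel (↥(maximalRealSubfield L)) L (IsCMField.complexConj L) 2))),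
        haveI : (νR c).IsMulRightInvariant :=
          isMulRightInvariant_centralizer_of_forall_cl_ne_two
            (isConjInvariant_borelRefine isConjInvariant_charpoly_adelicVal) hc (γ := (⟨(quasiSplit (↥(maximalRealSubfield L)) L (IsCMField.complexConj L) 2).toAdelic (Quotient.out c), Quotient.out c, rfl⟩ : ↥(quasiSplit (↥(maximalRealSubfield L)) L (IsCMField.complexConj L) 2).arithmeticSubgroup)) rfl (νR c);
        haveI : (νR c).IsInvInvariant :=
          isInvInvariant_centralizer_of_forall_cl_ne_two
            (isConjInvariant_borelRefine isConjInvariant_charpoly_adelicVal) hc (γ := (⟨(quasiSplit (↥(maximalRealSubfield L)) L (IsCMField.complexConj L) 2).toAdelic (Quotient.out c), Quotient.out c, rfl⟩ : ↥(quasiSplit (↥(maximalRealSubfield L)) L (IsCMField.complexConj L) 2).arithmeticSubgroup)) rfl (νR c);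
        m c = quotientMeasure (Subgroup.centralizer ({(quasiSplit (↥(maximalRealSubfield L)) L (IsCMField.complexConj L) 2).toAdelic (Quotient.out c)} : Set (quasiSplit (↥(maximalRealSubfield L)) L (IsCMField.complexConj L) 2).Adelic)) (νR c)
          (isClosed_centralizer_quasiSplit _) ν) →
    ∃ P : (AdeleRing (𝓞 L) L)[X] × Bool → ℂ[X],
      (∀ i, (P i).natDegree ≤ 1) ∧
      (∀ i ∈ (finite_setOf_borelRefine_charpoly_of_isCompact (F := ↥(maximalRealSubfield L)) (E := L) (c := IsCMField.complexConj L) (N := 2)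
          hf.hasCompactSupport'.isCompact).toFinset,
        ∃ T₀ : ℝ≥0, ∀ T : ℝ≥0, T₀ < T →
        truncatedTraceClass μ ν₀ 𝓕 T
          (fun γ : ↥(quasiSplit (↥(maximalRealSubfield L)) L (IsCMField.complexConj L) 2).arithmeticSubgroup =>
            (((adelicVal (↥(maximalRealSubfield L)) L (IsCMField.complexConj L) 2 _ (γ : (quasiSplit (↥(maximalRealSubfield L)) L (IsCMField.complexConj L) 2).Adelic) :
                GL (Fin 2) (AdeleRing (𝓞 L) L)) : Matrix (Fin 2) (Fin 2) (AdeleRing (𝓞 L) L)).charpoly,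
              decide (∃ δ : ↥(quasiSplit (↥(maximalRealSubfield L)) L (IsCMField.complexConj L) 2).arithmeticSubgroup, δ * γ * δ⁻¹ ∈ arithmeticBorel (↥(maximalRealSubfield L)) L (IsCMField.complexConj L) 2))) i f = (P i).eval ((Real.log (T : ℝ) : ℝ) : ℂ)) ∧
      truncatedTracePolynomial μ ν₀ 𝓕 f =
        ∑ i ∈ (finite_setOf_borelRefine_charpoly_of_isCompact (F := ↥(maximalRealSubfield L)) (E := L) (c := IsCMField.complexConj L) (N := 2)
          hf.hasCompactSupport'.isCompact).toFinset, P i ∧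
      (∀ i ∈ (finite_setOf_borelRefine_charpoly_of_isCompact (F := ↥(maximalRealSubfield L)) (E := L) (c := IsCMField.complexConj L) (N := 2)
          hf.hasCompactSupport'.isCompact).toFinset,
        (∀ β : ↥(arithmeticBorel (↥(maximalRealSubfield L)) L (IsCMField.complexConj L) 2),
          (((adelicVal (↥(maximalRealSubfield L)) L (IsCMField.complexConj L) 2 _ ((β : ↥(quasiSplit (↥(maximalRealSubfield L)) L (IsCMField.complexConj L) 2).arithmeticSubgroup) : (quasiSplit (↥(maximalRealSubfield L)) L (IsCMField.complexConj L) 2).Adelic) :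
                GL (Fin 2) (AdeleRing (𝓞 L) L)) : Matrix (Fin 2) (Fin 2) (AdeleRing (𝓞 L) L)).charpoly,
              decide (∃ δ : ↥(quasiSplit (↥(maximalRealSubfield L)) L (IsCMField.complexConj L) 2).arithmeticSubgroup, δ * (β : ↥(quasiSplit (↥(maximalRealSubfield L)) L (IsCMField.complexConj L) 2).arithmeticSubgroup) * δ⁻¹ ∈ arithmeticBorel (↥(maximalRealSubfield L)) L (IsCMField.complexConj L) 2)) ≠ i) →
        ∀ T : ℝ≥0, P i = C (truncatedTraceClass μ ν₀ 𝓕 T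
          (fun γ : ↥(quasiSplit (↥(maximalRealSubfield L)) L (IsCMField.complexConj L) 2).arithmeticSubgroup =>
            (((adelicVal (↥(maximalRealSubfield L)) L (IsCMField.complexConj L) 2 _ (γ : (quasiSplit (↥(maximalRealSubfield L)) L (IsCMField.complexConj L) 2).Adelic) :
                GL (Fin 2) (AdeleRing (𝓞 L) L)) : Matrix (Fin 2) (Fin 2) (AdeleRing (𝓞 L) L)).charpoly,
              decide (∃ δ : ↥(quasiSplit (↥(maximalRealSubfield L)) L (IsCMField.complexConj L) 2).arithmeticSubgroup, δ * γ * δ⁻¹ ∈ arithmeticBorel (↥(maximalRealSubfield L)) L (IsCMField.complexConj L) 2))) i f)) ∧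
      ∀ T : ℝ≥0, arthurTrace μ ν₀ 𝓕 f =
        (∑ i ∈ (((finite_setOf_borelRefine_charpoly_of_isCompact (F := ↥(maximalRealSubfield L)) (E := L) (c := IsCMField.complexConj L) (N := 2)
          hf.hasCompactSupport'.isCompact).toFinset).filter (fun i => ∀ β : ↥(arithmeticBorel (↥(maximalRealSubfield L)) L (IsCMField.complexConj L) 2),
            (((adelicVal (↥(maximalRealSubfield L)) L (IsCMField.complexConj L) 2 _ ((β : ↥(quasiSplit (↥(maximalRealSubfield L)) L (IsCMField.complexConj L) 2).arithmeticSubgroup) : (quasiSplit (↥(maximalRealSubfield L)) L (IsCMField.complexConj L) 2).Adelic) :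
                GL (Fin 2) (AdeleRing (𝓞 L) L)) : Matrix (Fin 2) (Fin 2) (AdeleRing (𝓞 L) L)).charpoly,
              decide (∃ δ : ↥(quasiSplit (↥(maximalRealSubfield L)) L (IsCMField.complexConj L) 2).arithmeticSubgroup, δ * (β : ↥(quasiSplit (↥(maximalRealSubfield L)) L (IsCMField.complexConj L) 2).arithmeticSubgroup) * δ⁻¹ ∈ arithmeticBorel (↥(maximalRealSubfield L)) L (IsCMField.complexConj L) 2)) ≠ i)).attach,
          ((unfoldingConstant (quasiSplit (↥(maximalRealSubfield L)) L (IsCMField.complexConj L) 2).quotientSubgroup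
              (count : Measure (quasiSplit (↥(maximalRealSubfield L)) L (IsCMField.complexConj L) 2).quotientSubgroup) μ ν : ℝ) : ℂ) *
            ∑' c : {c : ConjClasses (quasiSplit (↥(maximalRealSubfield L)) L (IsCMField.complexConj L) 2).Rational //
                (((adelicVal (↥(maximalRealSubfield L)) L (IsCMField.complexConj L) 2 _ ((⟨(quasiSplit (↥(maximalRealSubfield L)) L (IsCMField.complexConj L) 2).toAdelic (Quotient.out c), Quotient.out c, rfl⟩ : ↥(quasiSplit (↥(maximalRealSubfield L)) L (IsCMField.complexConj L) 2).arithmeticSubgroup) : (quasiSplit (↥(maximalRealSubfield L)) L (IsCMField.complexConj L) 2).Adelic) :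
                GL (Fin 2) (AdeleRing (𝓞 L) L)) : Matrix (Fin 2) (Fin 2) (AdeleRing (𝓞 L) L)).charpoly,
              decide (∃ δ : ↥(quasiSplit (↥(maximalRealSubfield L)) L (IsCMField.complexConj L) 2).arithmeticSubgroup, δ * ((⟨(quasiSplit (↥(maximalRealSubfield L)) L (IsCMField.complexConj L) 2).toAdelic (Quotient.out c), Quotient.out c, rfl⟩ : ↥(quasiSplit (↥(maximalRealSubfield L)) L (IsCMField.complexConj L) 2).arithmeticSubgroup)) * δ⁻¹ ∈ arithmeticBorel (↥(maximalRealSubfield L)) L (IsCMField.complexConj L) 2)) = i.1},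
              (haveI : (νR c.1).IsMulRightInvariant :=
                  isMulRightInvariant_centralizer_of_forall_cl_ne_two
                    (isConjInvariant_borelRefine isConjInvariant_charpoly_adelicVal) (Finset.mem_filter.1 i.2).2 c.2 (νR c.1);
                haveI : (νR c.1).IsInvInvariant :=
                  isInvInvariant_centralizer_of_forall_cl_ne_two
                    (isConjInvariant_borelRefine isConjInvariant_charpoly_adelicVal) (Finset.mem_filter.1 i.2).2 c.2 (νR c.1);
                ((quotientMeasure (((quasiSplit (↥(maximalRealSubfield L)) L (IsCMField.complexConj L) 2).quotientSubgroup ⊓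
                    Subgroup.centralizer ({(quasiSplit (↥(maximalRealSubfield L)) L (IsCMField.complexConj L) 2).toAdelic (Quotient.out c.1)} : Set (quasiSplit (↥(maximalRealSubfield L)) L (IsCMField.complexConj L) 2).Adelic)).subgroupOf
                    (Subgroup.centralizer ({(quasiSplit (↥(maximalRealSubfield L)) L (IsCMField.complexConj L) 2).toAdelic (Quotient.out c.1)} : Set (quasiSplit (↥(maximalRealSubfield L)) L (IsCMField.complexConj L) 2).Adelic)))
                    count (isClosed_inf_centralizer_subgroupOf_quasiSplit _) (νR c.1) Set.univ).toReal : ℂ) *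
                  classOrbitalIntegralAlong (quasiSplit (↥(maximalRealSubfield L)) L (IsCMField.complexConj L) 2).toAdelic m f c.1)) +
        ((∑ i ∈ ((finite_setOf_borelRefine_charpoly_of_isCompact (F := ↥(maximalRealSubfield L)) (E := L) (c := IsCMField.complexConj L) (N := 2)
          hf.hasCompactSupport'.isCompact).toFinset).filter (fun i : (AdeleRing (𝓞 L) L)[X] × Bool => i.2 = true ∧
            ∃ z : Lˣ, (IsCMField.complexConj L) (z : L) * (z : L) = 1 ∧
              i.1 = ((X - C (z : L)) ^ 2).map (algebraMap L (AdeleRing (𝓞 L) L))),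
            (P i).eval 0) +
          (∑ i ∈ ((finite_setOf_borelRefine_charpoly_of_isCompact (F := ↥(maximalRealSubfield L)) (E := L) (c := IsCMField.complexConj L) (N := 2)
          hf.hasCompactSupport'.isCompact).toFinset).filter (fun i : (AdeleRing (𝓞 L) L)[X] × Bool => i.2 = true ∧
            ∃ a : Lˣ, (IsCMField.complexConj L) (a : L) * (a : L) ≠ 1 ∧
              i.1 = ((X - C (a : L)) * (X - C ((IsCMField.complexConj L) (a : L))⁻¹)).map (algebraMap L (AdeleRing (𝓞 L) L))),
            (P i).eval 0)) := by
  intro hm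
  classical
  -- the diagonal embedding as an isomorphism onto the arithmetic subgroup (stated ONCE in `quasiSplit` letters), and the induced bijection of classes
  have hinj : Function.Injective (quasiSplit (↥(maximalRealSubfield L)) L (IsCMField.complexConj L) 2).toAdelic :=
    cmDatum_toAdelic_injective L 2 ((StdForm.antidiagonal 2).over L)
  let ιE : (quasiSplit (↥(maximalRealSubfield L)) L (IsCMField.complexConj L) 2).Rational ≃* (quasiSplit (↥(maximalRealSubfield L)) L (IsCMField.complexConj L) 2).arithmeticSubgroup := MonoidHom.ofInjective hinj
  let e : ConjClasses (quasiSplit (↥(maximalRealSubfield L)) L (IsCMField.complexConj L) 2).Rational ≃ ConjClasses (quasiSplit (↥(maximalRealSubfield L)) L (IsCMField.complexConj L) 2).arithmeticSubgroup :=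
    Equiv.ofBijective _ (Literature.NumberTheory.Rogawski1990.bijective_conjClassesMap_of_mulEquiv ιE)
  have he_mk : ∀ γ : (quasiSplit (↥(maximalRealSubfield L)) L (IsCMField.complexConj L) 2).Rational, e (ConjClasses.mk γ) = ConjClasses.mk (ιE γ) := fun γ => rfl
  -- the section `rep s := (out (e⁻¹ s))·1` and the centraliser measures read through `e.symm`
  let rep : ConjClasses (quasiSplit (↥(maximalRealSubfield L)) L (IsCMField.complexConj L) 2).arithmeticSubgroup → (quasiSplit (↥(maximalRealSubfield L)) L (IsCMField.complexConj L) 2).arithmeticSubgroup :=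
    fun s => ⟨(quasiSplit (↥(maximalRealSubfield L)) L (IsCMField.complexConj L) 2).toAdelic (Quotient.out (e.symm s)), Quotient.out (e.symm s), rfl⟩
  have hrep : ∀ s, ConjClasses.mk (rep s) = s := fun s => by
    have h1 : rep s = ιE (Quotient.out (e.symm s)) := Subtype.ext (MonoidHom.ofInjective_apply hinj).symm
    rw [h1, ← he_mk, conjClasses_mk_out₆, Equiv.apply_symm_apply]
  let νC' : ∀ s : ConjClasses (quasiSplit (↥(maximalRealSubfield L)) L (IsCMField.complexConj L) 2).arithmeticSubgroup,
      Measure ↥(Subgroup.centralizer ({((rep s : (quasiSplit (↥(maximalRealSubfield L)) L (IsCMField.complexConj L) 2).arithmeticSubgroup) : (quasiSplit (↥(maximalRealSubfield L)) L (IsCMField.complexConj L) 2).Adelic)} : Set (quasiSplit (↥(maximalRealSubfield L)) L (IsCMField.complexConj L) 2).Adelic)) :=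
    fun s => νR (e.symm s)
  haveI hνC' : ∀ s, (νC' s).IsHaarMeasure := fun s => (inferInstance : (νR (e.symm s)).IsHaarMeasure)
  -- ★ the two sockets at this section
  have hC5 :=
    @arthurTrace_eq_sum_orbital_add_sum_central_add_sum_hyperbolic_cm_two L _ _ _ instMA instBA ν instν μ instμ instMU instBU
      instMQ instBQ instMS instBS ν₀ instν₀ 𝓕 h𝓕 rep hrep νC' hνC' f hf
  obtain ⟨P, hrest⟩ := hC5
  refine ⟨P, hrest.1, hrest.2.1, hrest.2.2.1, hrest.2.2.2.1, fun T => (hrest.2.2.2.2 T).trans (congrArg₂ (· + ·) ?_ rfl)⟩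
  -- only the elliptic sum moves; summand by summand, re-index along `s ↦ e.symm s` and read the orbit measure through `hm`
  refine Finset.sum_congr rfl fun i _ => congrArg₂ (· * ·) rfl ?_
  refine tsum_subtype_reindex₆ e.symm
    (fun c => (((adelicVal (↥(maximalRealSubfield L)) L (IsCMField.complexConj L) 2 _ ((⟨(quasiSplit (↥(maximalRealSubfield L)) L (IsCMField.complexConj L) 2).toAdelic (Quotient.out c), Quotient.out c, rfl⟩ : ↥(quasiSplit (↥(maximalRealSubfield L)) L (IsCMField.complexConj L) 2).arithmeticSubgroup) : (quasiSplit (↥(maximalRealSubfield L)) L (IsCMField.complexConj L) 2).Adelic) :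
                GL (Fin 2) (AdeleRing (𝓞 L) L)) : Matrix (Fin 2) (Fin 2) (AdeleRing (𝓞 L) L)).charpoly,
              decide (∃ δ : ↥(quasiSplit (↥(maximalRealSubfield L)) L (IsCMField.complexConj L) 2).arithmeticSubgroup, δ * ((⟨(quasiSplit (↥(maximalRealSubfield L)) L (IsCMField.complexConj L) 2).toAdelic (Quotient.out c), Quotient.out c, rfl⟩ : ↥(quasiSplit (↥(maximalRealSubfield L)) L (IsCMField.complexConj L) 2).arithmeticSubgroup)) * δ⁻¹ ∈ arithmeticBorel (↥(maximalRealSubfield L)) L (IsCMField.complexConj L) 2)) = i.1) _ _ fun s => ?_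
  exact congrArg₂ (· * ·) rfl
    (classOrbitalIntegralAlong_eq_of_eq₆ (quasiSplit (↥(maximalRealSubfield L)) L (IsCMField.complexConj L) 2).toAdelic m f _
      (hm (e.symm s.1) (fun β hβ => (Finset.mem_filter.1 i.2).2 β (hβ.trans s.2)))).symm


/-! ## §3 The same AT THE WEIL MEASURE `μ = ν ∕ count`: no constant (★ `UnitaryGroupQuasiSplitWeilMeasure`: `c_{ν∕count} = 1`) -/
/-- **LAW 5's TWO SOCKETS OF `U(J₂)` IN KIT CURRENCY AT THE WEIL MEASURE — NO constant**: §2 for `μ = ν ∕ count` (equation antecedent after the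
preamble, as ★ (L4-g)₂ §2; the instance `IsAutomorphicMeasure μ` stays the caller's), Weil's constant being `1`
(★ `AdelicGroupData.ofReal_coe_unfoldingConstant_quotientMeasure_eq_one`): the elliptic weights ARE the covolumes `covol(G_{γ_c}(L⁺)·1 ∖ G_{γ_c}(𝔸); νR c)`.
The `N = 2` twin of ★ `arthurTrace_eq_sum_classOrbitalIntegralAlong_add_three_sockets_of_eq_quotientMeasure_cm`.
[cite: Rogawski1990, §2.2–2.3 (pp. 13–14); §14.5 pp. 237–238; §5.4 p. 71] [cite: Arthur1978TraceFormulaI, §8] [cite: Gelbart1975, (9.13) and Thm. 9.22 (ii)] -/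
theorem arthurTrace_eq_sum_classOrbitalIntegralAlong_add_two_sockets_of_eq_quotientMeasure_cm_two (L : Type) [Field L] [NumberField L] [IsCMField L]
    [instMA : MeasurableSpace (quasiSplit (↥(maximalRealSubfield L)) L (IsCMField.complexConj L) 2).Adelic] [instBA : BorelSpace (quasiSplit (↥(maximalRealSubfield L)) L (IsCMField.complexConj L) 2).Adelic]
    (ν : Measure (quasiSplit (↥(maximalRealSubfield L)) L (IsCMField.complexConj L) 2).Adelic) [instν : IsHaarMeasure ν]
    (μ : Measure (quasiSplit (↥(maximalRealSubfield L)) L (IsCMField.complexConj L) 2).automorphicQuotient)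
    [instμ : (quasiSplit (↥(maximalRealSubfield L)) L (IsCMField.complexConj L) 2).IsAutomorphicMeasure μ]
    [instMU : MeasurableSpace (adelicUnipotent (↥(maximalRealSubfield L)) L (IsCMField.complexConj L) 2)]
    [instBU : BorelSpace (adelicUnipotent (↥(maximalRealSubfield L)) L (IsCMField.complexConj L) 2)]
    [instMQ : ∀ γ : (quasiSplit (↥(maximalRealSubfield L)) L (IsCMField.complexConj L) 2).Adelic,
      MeasurableSpace ((quasiSplit (↥(maximalRealSubfield L)) L (IsCMField.complexConj L) 2).Adelic ⧸
        Subgroup.centralizer ({γ} : Set (quasiSplit (↥(maximalRealSubfield L)) L (IsCMField.complexConj L) 2).Adelic))]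
    [instBQ : ∀ γ : (quasiSplit (↥(maximalRealSubfield L)) L (IsCMField.complexConj L) 2).Adelic,
      BorelSpace ((quasiSplit (↥(maximalRealSubfield L)) L (IsCMField.complexConj L) 2).Adelic ⧸
        Subgroup.centralizer ({γ} : Set (quasiSplit (↥(maximalRealSubfield L)) L (IsCMField.complexConj L) 2).Adelic))]
    [instMS : ∀ γ : (quasiSplit (↥(maximalRealSubfield L)) L (IsCMField.complexConj L) 2).Adelic,
      MeasurableSpace (↥(Subgroup.centralizer ({γ} : Set (quasiSplit (↥(maximalRealSubfield L)) L (IsCMField.complexConj L) 2).Adelic)) ⧸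
        ((quasiSplit (↥(maximalRealSubfield L)) L (IsCMField.complexConj L) 2).quotientSubgroup ⊓
          Subgroup.centralizer ({γ} : Set (quasiSplit (↥(maximalRealSubfield L)) L (IsCMField.complexConj L) 2).Adelic)).subgroupOf
          (Subgroup.centralizer ({γ} : Set (quasiSplit (↥(maximalRealSubfield L)) L (IsCMField.complexConj L) 2).Adelic)))]
    [instBS : ∀ γ : (quasiSplit (↥(maximalRealSubfield L)) L (IsCMField.complexConj L) 2).Adelic,
      BorelSpace (↥(Subgroup.centralizer ({γ} : Set (quasiSplit (↥(maximalRealSubfield L)) L (IsCMField.complexConj L) 2).Adelic)) ⧸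
        ((quasiSplit (↥(maximalRealSubfield L)) L (IsCMField.complexConj L) 2).quotientSubgroup ⊓
          Subgroup.centralizer ({γ} : Set (quasiSplit (↥(maximalRealSubfield L)) L (IsCMField.complexConj L) 2).Adelic)).subgroupOf
          (Subgroup.centralizer ({γ} : Set (quasiSplit (↥(maximalRealSubfield L)) L (IsCMField.complexConj L) 2).Adelic)))]
    (ν₀ : Measure (adelicUnipotent (↥(maximalRealSubfield L)) L (IsCMField.complexConj L) 2)) [instν₀ : ν₀.IsHaarMeasure]
    (𝓕 : Set (adelicUnipotent (↥(maximalRealSubfield L)) L (IsCMField.complexConj L) 2))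
    (h𝓕 : IsFundamentalDomain (rationalUnipotent (↥(maximalRealSubfield L)) L (IsCMField.complexConj L) 2) 𝓕 ν₀)
    (νR : ∀ c : ConjClasses (quasiSplit (↥(maximalRealSubfield L)) L (IsCMField.complexConj L) 2).Rational,
      Measure ↥(Subgroup.centralizer ({(quasiSplit (↥(maximalRealSubfield L)) L (IsCMField.complexConj L) 2).toAdelic (Quotient.out c)} : Set (quasiSplit (↥(maximalRealSubfield L)) L (IsCMField.complexConj L) 2).Adelic)))
    [instνR : ∀ c, IsHaarMeasure (νR c)]
    (m : ∀ c : ConjClasses (quasiSplit (↥(maximalRealSubfield L)) L (IsCMField.complexConj L) 2).Rational,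
      Measure ((quasiSplit (↥(maximalRealSubfield L)) L (IsCMField.complexConj L) 2).Adelic ⧸ Subgroup.centralizer ({(quasiSplit (↥(maximalRealSubfield L)) L (IsCMField.complexConj L) 2).toAdelic (Quotient.out c)} : Set (quasiSplit (↥(maximalRealSubfield L)) L (IsCMField.complexConj L) 2).Adelic)))
    (f : (quasiSplit (↥(maximalRealSubfield L)) L (IsCMField.complexConj L) 2).Adelic → ℂ)
    (hf : IsQuasiSplitTest (↥(maximalRealSubfield L)) L (IsCMField.complexConj L) 2 f) :
    haveI := t2Space_quasiSplitAdelic (F := ↥(maximalRealSubfield L)) (E := L) (c := IsCMField.complexConj L) (N := 2)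
    haveI := locallyCompactSpace_quasiSplitAdelic (F := ↥(maximalRealSubfield L)) (E := L) (c := IsCMField.complexConj L) (N := 2)
    haveI := secondCountableTopology_quasiSplitAdelic (F := ↥(maximalRealSubfield L)) (E := L) (c := IsCMField.complexConj L) (N := 2)
    haveI : IsClosed (((quasiSplit (↥(maximalRealSubfield L)) L (IsCMField.complexConj L) 2).quotientSubgroup : Set (quasiSplit (↥(maximalRealSubfield L)) L (IsCMField.complexConj L) 2).Adelic)) :=
      isClosed_quotientSubgroup_quasiSplit
    haveI : ∀ γ : (quasiSplit (↥(maximalRealSubfield L)) L (IsCMField.complexConj L) 2).Adelic, IsClosed ((Subgroup.centralizer ({γ} : Set (quasiSplit (↥(maximalRealSubfield L)) L (IsCMField.complexConj L) 2).Adelic) :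
        Subgroup (quasiSplit (↥(maximalRealSubfield L)) L (IsCMField.complexConj L) 2).Adelic) : Set (quasiSplit (↥(maximalRealSubfield L)) L (IsCMField.complexConj L) 2).Adelic) := isClosed_centralizer_quasiSplit
    haveI : ∀ γ : (quasiSplit (↥(maximalRealSubfield L)) L (IsCMField.complexConj L) 2).Adelic, (count : Measure ↥(((quasiSplit (↥(maximalRealSubfield L)) L (IsCMField.complexConj L) 2).quotientSubgroup ⊓
        Subgroup.centralizer ({γ} : Set (quasiSplit (↥(maximalRealSubfield L)) L (IsCMField.complexConj L) 2).Adelic)).subgroupOf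
          (Subgroup.centralizer ({γ} : Set (quasiSplit (↥(maximalRealSubfield L)) L (IsCMField.complexConj L) 2).Adelic)))).IsHaarMeasure :=
      isHaarMeasure_count_inf_centralizer_subgroupOf_quasiSplit
    haveI : (count : Measure (quasiSplit (↥(maximalRealSubfield L)) L (IsCMField.complexConj L) 2).quotientSubgroup).IsHaarMeasure :=
      isHaarMeasure_count_quotientSubgroup_quasiSplit
    haveI : ν.IsMulRightInvariant := isMulRightInvariant_quasiSplit_cm_two L ν
    letI := AdelicGroupData.measurableSpaceQuotientForm (quasiSplit (↥(maximalRealSubfield L)) L (IsCMField.complexConj L) 2)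
    haveI := AdelicGroupData.borelSpaceQuotientForm (quasiSplit (↥(maximalRealSubfield L)) L (IsCMField.complexConj L) 2)
    haveI := AdelicGroupData.smulInvariantMeasureQuotientForm (quasiSplit (↥(maximalRealSubfield L)) L (IsCMField.complexConj L) 2) μ
    haveI := AdelicGroupData.isFiniteMeasureOnCompactsQuotientForm (quasiSplit (↥(maximalRealSubfield L)) L (IsCMField.complexConj L) 2) μ
    μ = quotientMeasure (quasiSplit (↥(maximalRealSubfield L)) L (IsCMField.complexConj L) 2).quotientSubgroup (count : Measure (quasiSplit (↥(maximalRealSubfield L)) L (IsCMField.complexConj L) 2).quotientSubgroup)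
          (isClosed_quotientSubgroup_quasiSplit (F := ↥(maximalRealSubfield L)) (E := L) (c := IsCMField.complexConj L)) ν →
    (∀ (c : ConjClasses (quasiSplit (↥(maximalRealSubfield L)) L (IsCMField.complexConj L) 2).Rational)
        (hc : ∀ β : ↥(arithmeticBorel (↥(maximalRealSubfield L)) L (IsCMField.complexConj L) 2),
          (((adelicVal (↥(maximalRealSubfield L)) L (IsCMField.complexConj L) 2 _ ((β : ↥(quasiSplit (↥(maximalRealSubfield L)) L (IsCMField.complexConj L) 2).arithmeticSubgroup) : (quasiSplit (↥(maximalRealSubfield L)) L (IsCMField.complexConj L) 2).Adelic) :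
                GL (Fin 2) (AdeleRing (𝓞 L) L)) : Matrix (Fin 2) (Fin 2) (AdeleRing (𝓞 L) L)).charpoly,
              decide (∃ δ : ↥(quasiSplit (↥(maximalRealSubfield L)) L (IsCMField.complexConj L) 2).arithmeticSubgroup, δ * (β : ↥(quasiSplit (↥(maximalRealSubfield L)) L (IsCMField.complexConj L) 2).arithmeticSubgroup) * δ⁻¹ ∈ arithmeticBorel (↥(maximalRealSubfield L)) L (IsCMField.complexConj L) 2)) ≠
          (((adelicVal (↥(maximalRealSubfield L)) L (IsCMField.complexConj L) 2 _ ((⟨(quasiSplit (↥(maximalRealSubfield L)) L (IsCMField.complexConj L) 2).toAdelic (Quotient.out c), Quotient.out c, rfl⟩ : ↥(quasiSplit (↥(maximalRealSubfield L)) L (IsCMField.complexConj L) 2).arithmeticSubgroup) : (quasiSplit (↥(maximalRealSubfield L)) L (IsCMField.complexConj L) 2).Adelic) :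
                GL (Fin 2) (AdeleRing (𝓞 L) L)) : Matrix (Fin 2) (Fin 2) (AdeleRing (𝓞 L) L)).charpoly,
              decide (∃ δ : ↥(quasiSplit (↥(maximalRealSubfield L)) L (IsCMField.complexConj L) 2).arithmeticSubgroup, δ * ((⟨(quasiSplit (↥(maximalRealSubfield L)) L (IsCMField.complexConj L) 2).toAdelic (Quotient.out c), Quotient.out c, rfl⟩ : ↥(quasiSplit (↥(maximalRealSubfield L)) L (IsCMField.complexConj L) 2).arithmeticSubgroup)) * δ⁻¹ ∈ arithmeticBorel (↥(maximalRealSubfield L)) L (IsCMField.complexConj L) 2))),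
        haveI : (νR c).IsMulRightInvariant :=
          isMulRightInvariant_centralizer_of_forall_cl_ne_two
            (isConjInvariant_borelRefine isConjInvariant_charpoly_adelicVal) hc (γ := (⟨(quasiSplit (↥(maximalRealSubfield L)) L (IsCMField.complexConj L) 2).toAdelic (Quotient.out c), Quotient.out c, rfl⟩ : ↥(quasiSplit (↥(maximalRealSubfield L)) L (IsCMField.complexConj L) 2).arithmeticSubgroup)) rfl (νR c);
        haveI : (νR c).IsInvInvariant :=
          isInvInvariant_centralizer_of_forall_cl_ne_two
            (isConjInvariant_borelRefine isConjInvariant_charpoly_adelicVal) hc (γ := (⟨(quasiSplit (↥(maximalRealSubfield L)) L (IsCMField.complexConj L) 2).toAdelic (Quotient.out c), Quotient.out c, rfl⟩ : ↥(quasiSplit (↥(maximalRealSubfield L)) L (IsCMField.complexConj L) 2).arithmeticSubgroup)) rfl (νR c);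
        m c = quotientMeasure (Subgroup.centralizer ({(quasiSplit (↥(maximalRealSubfield L)) L (IsCMField.complexConj L) 2).toAdelic (Quotient.out c)} : Set (quasiSplit (↥(maximalRealSubfield L)) L (IsCMField.complexConj L) 2).Adelic)) (νR c)
          (isClosed_centralizer_quasiSplit _) ν) →
    ∃ P : (AdeleRing (𝓞 L) L)[X] × Bool → ℂ[X],
      (∀ i, (P i).natDegree ≤ 1) ∧
      (∀ i ∈ (finite_setOf_borelRefine_charpoly_of_isCompact (F := ↥(maximalRealSubfield L)) (E := L) (c := IsCMField.complexConj L) (N := 2)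
          hf.hasCompactSupport'.isCompact).toFinset,
        ∃ T₀ : ℝ≥0, ∀ T : ℝ≥0, T₀ < T →
        truncatedTraceClass μ ν₀ 𝓕 T
          (fun γ : ↥(quasiSplit (↥(maximalRealSubfield L)) L (IsCMField.complexConj L) 2).arithmeticSubgroup =>
            (((adelicVal (↥(maximalRealSubfield L)) L (IsCMField.complexConj L) 2 _ (γ : (quasiSplit (↥(maximalRealSubfield L)) L (IsCMField.complexConj L) 2).Adelic) :
                GL (Fin 2) (AdeleRing (𝓞 L) L)) : Matrix (Fin 2) (Fin 2) (AdeleRing (𝓞 L) L)).charpoly,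
              decide (∃ δ : ↥(quasiSplit (↥(maximalRealSubfield L)) L (IsCMField.complexConj L) 2).arithmeticSubgroup, δ * γ * δ⁻¹ ∈ arithmeticBorel (↥(maximalRealSubfield L)) L (IsCMField.complexConj L) 2))) i f = (P i).eval ((Real.log (T : ℝ) : ℝ) : ℂ)) ∧
      truncatedTracePolynomial μ ν₀ 𝓕 f =
        ∑ i ∈ (finite_setOf_borelRefine_charpoly_of_isCompact (F := ↥(maximalRealSubfield L)) (E := L) (c := IsCMField.complexConj L) (N := 2)
          hf.hasCompactSupport'.isCompact).toFinset, P i ∧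
      (∀ i ∈ (finite_setOf_borelRefine_charpoly_of_isCompact (F := ↥(maximalRealSubfield L)) (E := L) (c := IsCMField.complexConj L) (N := 2)
          hf.hasCompactSupport'.isCompact).toFinset,
        (∀ β : ↥(arithmeticBorel (↥(maximalRealSubfield L)) L (IsCMField.complexConj L) 2),
          (((adelicVal (↥(maximalRealSubfield L)) L (IsCMField.complexConj L) 2 _ ((β : ↥(quasiSplit (↥(maximalRealSubfield L)) L (IsCMField.complexConj L) 2).arithmeticSubgroup) : (quasiSplit (↥(maximalRealSubfield L)) L (IsCMField.complexConj L) 2).Adelic) :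
                GL (Fin 2) (AdeleRing (𝓞 L) L)) : Matrix (Fin 2) (Fin 2) (AdeleRing (𝓞 L) L)).charpoly,
              decide (∃ δ : ↥(quasiSplit (↥(maximalRealSubfield L)) L (IsCMField.complexConj L) 2).arithmeticSubgroup, δ * (β : ↥(quasiSplit (↥(maximalRealSubfield L)) L (IsCMField.complexConj L) 2).arithmeticSubgroup) * δ⁻¹ ∈ arithmeticBorel (↥(maximalRealSubfield L)) L (IsCMField.complexConj L) 2)) ≠ i) →
        ∀ T : ℝ≥0, P i = C (truncatedTraceClass μ ν₀ 𝓕 T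
          (fun γ : ↥(quasiSplit (↥(maximalRealSubfield L)) L (IsCMField.complexConj L) 2).arithmeticSubgroup =>
            (((adelicVal (↥(maximalRealSubfield L)) L (IsCMField.complexConj L) 2 _ (γ : (quasiSplit (↥(maximalRealSubfield L)) L (IsCMField.complexConj L) 2).Adelic) :
                GL (Fin 2) (AdeleRing (𝓞 L) L)) : Matrix (Fin 2) (Fin 2) (AdeleRing (𝓞 L) L)).charpoly,
              decide (∃ δ : ↥(quasiSplit (↥(maximalRealSubfield L)) L (IsCMField.complexConj L) 2).arithmeticSubgroup, δ * γ * δ⁻¹ ∈ arithmeticBorel (↥(maximalRealSubfield L)) L (IsCMField.complexConj L) 2))) i f)) ∧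
      ∀ T : ℝ≥0, arthurTrace μ ν₀ 𝓕 f =
        (∑ i ∈ (((finite_setOf_borelRefine_charpoly_of_isCompact (F := ↥(maximalRealSubfield L)) (E := L) (c := IsCMField.complexConj L) (N := 2)
          hf.hasCompactSupport'.isCompact).toFinset).filter (fun i => ∀ β : ↥(arithmeticBorel (↥(maximalRealSubfield L)) L (IsCMField.complexConj L) 2),
            (((adelicVal (↥(maximalRealSubfield L)) L (IsCMField.complexConj L) 2 _ ((β : ↥(quasiSplit (↥(maximalRealSubfield L)) L (IsCMField.complexConj L) 2).arithmeticSubgroup) : (quasiSplit (↥(maximalRealSubfield L)) L (IsCMField.complexConj L) 2).Adelic) :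
                GL (Fin 2) (AdeleRing (𝓞 L) L)) : Matrix (Fin 2) (Fin 2) (AdeleRing (𝓞 L) L)).charpoly,
              decide (∃ δ : ↥(quasiSplit (↥(maximalRealSubfield L)) L (IsCMField.complexConj L) 2).arithmeticSubgroup, δ * (β : ↥(quasiSplit (↥(maximalRealSubfield L)) L (IsCMField.complexConj L) 2).arithmeticSubgroup) * δ⁻¹ ∈ arithmeticBorel (↥(maximalRealSubfield L)) L (IsCMField.complexConj L) 2)) ≠ i)).attach,
            ∑' c : {c : ConjClasses (quasiSplit (↥(maximalRealSubfield L)) L (IsCMField.complexConj L) 2).Rational //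
                (((adelicVal (↥(maximalRealSubfield L)) L (IsCMField.complexConj L) 2 _ ((⟨(quasiSplit (↥(maximalRealSubfield L)) L (IsCMField.complexConj L) 2).toAdelic (Quotient.out c), Quotient.out c, rfl⟩ : ↥(quasiSplit (↥(maximalRealSubfield L)) L (IsCMField.complexConj L) 2).arithmeticSubgroup) : (quasiSplit (↥(maximalRealSubfield L)) L (IsCMField.complexConj L) 2).Adelic) :
                GL (Fin 2) (AdeleRing (𝓞 L) L)) : Matrix (Fin 2) (Fin 2) (AdeleRing (𝓞 L) L)).charpoly,
              decide (∃ δ : ↥(quasiSplit (↥(maximalRealSubfield L)) L (IsCMField.complexConj L) 2).arithmeticSubgroup, δ * ((⟨(quasiSplit (↥(maximalRealSubfield L)) L (IsCMField.complexConj L) 2).toAdelic (Quotient.out c), Quotient.out c, rfl⟩ : ↥(quasiSplit (↥(maximalRealSubfield L)) L (IsCMField.complexConj L) 2).arithmeticSubgroup)) * δ⁻¹ ∈ arithmeticBorel (↥(maximalRealSubfield L)) L (IsCMField.complexConj L) 2)) = i.1},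
              (haveI : (νR c.1).IsMulRightInvariant :=
                  isMulRightInvariant_centralizer_of_forall_cl_ne_two
                    (isConjInvariant_borelRefine isConjInvariant_charpoly_adelicVal) (Finset.mem_filter.1 i.2).2 c.2 (νR c.1);
                haveI : (νR c.1).IsInvInvariant :=
                  isInvInvariant_centralizer_of_forall_cl_ne_two
                    (isConjInvariant_borelRefine isConjInvariant_charpoly_adelicVal) (Finset.mem_filter.1 i.2).2 c.2 (νR c.1);
                ((quotientMeasure (((quasiSplit (↥(maximalRealSubfield L)) L (IsCMField.complexConj L) 2).quotientSubgroup ⊓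
                    Subgroup.centralizer ({(quasiSplit (↥(maximalRealSubfield L)) L (IsCMField.complexConj L) 2).toAdelic (Quotient.out c.1)} : Set (quasiSplit (↥(maximalRealSubfield L)) L (IsCMField.complexConj L) 2).Adelic)).subgroupOf
                    (Subgroup.centralizer ({(quasiSplit (↥(maximalRealSubfield L)) L (IsCMField.complexConj L) 2).toAdelic (Quotient.out c.1)} : Set (quasiSplit (↥(maximalRealSubfield L)) L (IsCMField.complexConj L) 2).Adelic)))
                    count (isClosed_inf_centralizer_subgroupOf_quasiSplit _) (νR c.1) Set.univ).toReal : ℂ) *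
                  classOrbitalIntegralAlong (quasiSplit (↥(maximalRealSubfield L)) L (IsCMField.complexConj L) 2).toAdelic m f c.1)) +
        ((∑ i ∈ ((finite_setOf_borelRefine_charpoly_of_isCompact (F := ↥(maximalRealSubfield L)) (E := L) (c := IsCMField.complexConj L) (N := 2)
          hf.hasCompactSupport'.isCompact).toFinset).filter (fun i : (AdeleRing (𝓞 L) L)[X] × Bool => i.2 = true ∧
            ∃ z : Lˣ, (IsCMField.complexConj L) (z : L) * (z : L) = 1 ∧
              i.1 = ((X - C (z : L)) ^ 2).map (algebraMap L (AdeleRing (𝓞 L) L))),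
            (P i).eval 0) +
          (∑ i ∈ ((finite_setOf_borelRefine_charpoly_of_isCompact (F := ↥(maximalRealSubfield L)) (E := L) (c := IsCMField.complexConj L) (N := 2)
          hf.hasCompactSupport'.isCompact).toFinset).filter (fun i : (AdeleRing (𝓞 L) L)[X] × Bool => i.2 = true ∧
            ∃ a : Lˣ, (IsCMField.complexConj L) (a : L) * (a : L) ≠ 1 ∧
              i.1 = ((X - C (a : L)) * (X - C ((IsCMField.complexConj L) (a : L))⁻¹)).map (algebraMap L (AdeleRing (𝓞 L) L))),
            (P i).eval 0)) := by
  intro hμ hm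
  have h := arthurTrace_eq_sum_classOrbitalIntegralAlong_add_sum_central_add_sum_hyperbolic_cm_two L ν μ ν₀ 𝓕 h𝓕 νR m f hf hm
  subst hμ
  haveI := t2Space_quasiSplitAdelic (F := ↥(maximalRealSubfield L)) (E := L) (c := IsCMField.complexConj L) (N := 2)
  haveI := locallyCompactSpace_quasiSplitAdelic (F := ↥(maximalRealSubfield L)) (E := L) (c := IsCMField.complexConj L) (N := 2)
  haveI := secondCountableTopology_quasiSplitAdelic (F := ↥(maximalRealSubfield L)) (E := L) (c := IsCMField.complexConj L) (N := 2)
  haveI : (count : Measure (quasiSplit (↥(maximalRealSubfield L)) L (IsCMField.complexConj L) 2).quotientSubgroup).IsHaarMeasure := isHaarMeasure_count_quotientSubgroup_quasiSplit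
  haveI : DiscreteTopology (quasiSplit (↥(maximalRealSubfield L)) L (IsCMField.complexConj L) 2).quotientSubgroup := discreteTopology_quotientSubgroup_quasiSplit
  haveI : ν.IsMulRightInvariant := isMulRightInvariant_quasiSplit_cm_two L ν
  have h1 := AdelicGroupData.ofReal_coe_unfoldingConstant_quotientMeasure_eq_one (quasiSplit (↥(maximalRealSubfield L)) L (IsCMField.complexConj L) 2)
    (isClosed_quotientSubgroup_quasiSplit (F := ↥(maximalRealSubfield L)) (E := L) (c := IsCMField.complexConj L)) count ν
  simp only [h1, one_mul] at h
  exact h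

end UnitaryGroup

end Literature.NumberTheory.Automorphic
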